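import Summits.QuantumFields.BalabanUV.T4Continuum.Support.T4TrajectoryDensityPerSliceWindow
import Summits.QuantumFields.BalabanUV.T4Continuum.Spine.NE1p.DressedWindowScheduleWin

/-!
# T⁴ programme, spine estimate NE1′ (node O3b/H2) — END-F WITH PER-STEP CHART AND SLICE WINDOWS (END-F-swin) and its
# window schedule (located finding F-ne1pleaf04-1; swarm rows S1c/S1d «S1-win» continued)

Cell `pub-balaban`, sub-cell `t4`, BINDER-OWNERS row NE1′, NE1′ formalisation swarm `b2b-balaban-t4-ne1p-formalise-*`, leaf prover
04 (rows S1 `DressedWindowSchedule` p212498, S1b `DressedTransportScheduled` p212785, S1d `DressedWindowScheduleWin` p213367);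
tree target `Summits/QuantumFields/BalabanUV/T4Continuum/Spine/NE1p/`; ADDITIVE — imports
`Support/T4TrajectoryDensityPerSliceWindow` (the `_swin` chain, this seat) and row S1d's `Spine/NE1p/DressedWindowScheduleWin`
ONLY; END-F (p211416), END-F′ (p212485), END-F-win (p213121) untouched.

WHY (finding F-ne1pleaf04-1).  END-F-win's `hP` — the centred perturbation slice of the met component — is typed on the uniform
direction window `w`; assembling it (`T4TrajectoryDensityAssembly(Mod)(Win).pertSlice_under_history…`) asks the cross-family
complex margin `hN2cx` for all directions `latN pd ≤ w`, which for bond-ball windows is the gap `ρw (k+1) + w + ϱ₁ k + σ k ≤ ρw k`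
— `K·w` of birth window (`WindowSchedule.window_budget`), cutoff-dependent (k1).  §1 **`transportLeaf_of_centredExponent_swin`**
is END-F-win with births, the action exponent and `hP` read on the per-step windows `wk b k′ k′` ∕ `wk b k′ (k+1)`; §2
**`transportLeaf_swin_of_schedule`** discharges its nine geometric binders from row S1d's `WindowScheduleWin` (same shapes as for
END-F-win) — so the cutoff-free witness `WindowScheduleWin.geometric` (finite birth window `ρ∞ + (1+2q)σ₀/(1−q)`) serves END-F-swin
verbatim, now with `hP` on the window `wc (k+1)`, the shape an assembly with summable cross-family consumption needs.  The
assembly itself (AssemblyMod with `hN2cx`/`hpairx` guarded at `latN pd ≤ wk b k′ (k+1)`) is NOT in this file.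

HONEST FRAMING.  Rung (B)+1 bookkeeping on ONE finite four-torus of fixed physical size — NOT infinite volume, NOT a mass gap, NOT
OS on ℝ⁴, NOT the Clay problem, NOT summit progress.  NE1′ is NOT PRINTED and NOT PROVED; this file reads «L-T ⇐ the displayed
binders (per-step slice-window form)», never «NE1′ proved»; every wall binder stays DISPLAYED ((w1) `hsl`, H2 `hFn`/`h𝒢`, (w2-act)
`hB`/`hE` — printed TYPE [Balaban1989LargeFieldII] (1.65) p. 375, (1.71)–(1.75) pp. 379–380, asserted for Bałaban's densities
NOWHERE —, `hP`, `hDμ`, (w4) `hdom`, (I4′) `hdefwk`/`hrate`, attainment, invariance); the schedule is a BINDER; 0 binders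
instantiated on Bałaban's densities; no `def … : Prop`; [folklore] kernel glue, 0 sorry, 0 citations used as facts.  Spine PROVED
0∕9 unchanged.  HONEST DEPENDENCY: continuum YM on T⁴ ⇐ BetaPertH ∧ nine spine estimates (0/9 proved); BetaPertH ⇐ (D1) ∧ (D4) ∧
CAP+tail; G-an2-4 gates asym, D1 and NE2/3/4.
-/

noncomputable section

namespace Summit.QuantumFields.BalabanUV.T4Continuum.NE1p.DressedRootSliceWin

open MeasureTheory Set Metric Filter Finset
open scoped BigOperators
open Literature.MathematicalPhysics.QuantumFieldTheory.Balaban1983to89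
open Literature.MathematicalPhysics.QuantumFieldTheory.Balaban1983to89.T4TermFormat
open Literature.MathematicalPhysics.QuantumFieldTheory.Balaban1983to89.T4TermFormat.Booking
open Literature.MathematicalPhysics.QuantumFieldTheory.Balaban1983to89.T4GatedBooking
open Literature.MathematicalPhysics.QuantumFieldTheory.Balaban1983to89.T4TrajectoryComparison
open Literature.MathematicalPhysics.QuantumFieldTheory.Balaban1983to89.T4TrajectoryModulus
open Summit.QuantumFields.BalabanUV.T4Continuum.T4TrajectoryDensityDressed
open Summit.QuantumFields.BalabanUV.T4Continuum.NE1p.DressedRoot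
open Summit.QuantumFields.BalabanUV.T4Continuum.NE1p.DressedWindowScheduleWin
open T4BirthChartTransport (GaugeInvariant BirthSlice RelGauge)
open T4BlockTransport (Fld NDir latMove latN latMove_zero)
open T4TrajectoryDensity

/-! ## §1 END-F-swin: the transport leaf under the dressed gate, per-step chart AND slice windows [bookkeeping] -/

section ENDFswin

variable {B : T4TermFormat.Booking} {T : Trajectory B}
variable {R : Type*} [NormedRing R] [NormedAlgebra ℂ R] [MeasurableSpace R] {d : ℕ}
  {F : Type*} [NormedAddCommGroup F] [NormedSpace ℂ F] [CompleteSpace F]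

/-- **END-F-swin — THE TRANSPORT LEAF `htr`, GATED BY THE DRESSED BUDGET, WITH PER-STEP CHART AND SLICE WINDOWS**
[bookkeeping]: leaf-08's END-F-win `DressedRootWin.transportLeaf_of_centredExponent_win` (p213121) VERBATIM except that every
SLICE is read on the per-step window too — births `hsl` on `wk b k′ k′`, the action exponent `hE` and the centred perturbation
`hP` of the met step `k` on `wk b k′ (k+1)` — and `hw` is gone (the uniform `w` survives only as the bound `hwk : wk ≤ w`,
`hθ.2`).  Proof: `T4TrajectoryDensityPerSliceWindow.transportsFromVar_of_centredExponent_lattice_fam_gated_swin` with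
`Gate := budgetGate …`, `s₁ b k := m·Σ_{f∈S k b} envVar …`, `hs := hs_of_budgetGate`.  Conclusion: EXACTLY the field `htr` of
`BookingLeaves` with `C = 4c_δ/r`, `ρ i = ψ·α i`.  The binders are WEAKER than END-F-win's (slice shapes are antitone in the
window); the point is downstream (finding F-ne1pleaf04-1): an `hP` on the window `wk b k′ (k+1)` is assembled from the live
generations with the cross-family complex margin asked only for directions `≤ wk b k′ (k+1)`, so a schedule's consumption per met
step is `wk (k+1) + ϱ₁ k + σ k` — summable — instead of `w + ϱ₁ k + σ k`.  Every wall binder stays displayed; nothing of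
Bałaban's densities is asserted. [folklore] -/
theorem transportLeaf_of_centredExponent_swin {Fn : B.Birth → ℕ → ℕ → Fld d R → F}
    {rel : B.Birth → ℕ → ℕ → Fld d R → Fld d R → Prop} {𝒦 : B.Birth → ℕ → ℕ → Set (Fld d R)}
    {ref : B.Birth → ℕ → Fld d R → Fld d R} {base : B.Birth → ℕ → Fld d R → ℝ}
    {𝒜 𝒬 : B.Birth → ℕ → Fld d R → Fld d R → ℂ} {q : B.Birth → ℕ → Fld d R → ℂ}
    {μ : B.Birth → ℕ → Measure (Fld d R)} {z₀ : B.Birth → ℕ → Fld d R} {D : B.Birth → ℕ → Set (Fld d R)}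
    {defect wk : B.Birth → ℕ → ℕ → ℝ} {cδ ψ w r m : ℝ} {s θ : B.Birth → ℕ → ℝ} {α : ℕ → ℝ}
    {ϱ : B.Birth → ℕ → ℕ → ℝ} {S : ℕ → B.Birth → Finset B.Birth}
    (hα : ∀ i, 0 ≤ α i) (hr : 0 < r)
    (hsl : ∀ (b : B.Birth) (k' : ℕ), B.birthScale b ≤ k' → k' ≤ B.K →
      RanBelow (budgetGate T s m S (4 * cδ / r) (fun i => ψ * α i)) k' →
      BirthSlice (Fn b k' k') latMove latN (𝒦 b k' k') (wk b k' k') r (T.gen b k'))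
    (hFn : ∀ (b : B.Birth) (k' k : ℕ), B.birthScale b ≤ k' → k' ≤ k → k + 1 ≤ B.K →
      RanBelow (budgetGate T s m S (4 * cδ / r) (fun i => ψ * α i)) (k + 1) →
      ∀ U, Fn b k' (k + 1) U =
        wOp (expWeight (base b k) (𝒜 b k + 𝒬 b k)) (μ b k) (z₀ b k) U (fun z => Fn b k' k (U + z)))
    (h𝒢 : ∀ (b : B.Birth) (k' k : ℕ), B.birthScale b ≤ k' → k' ≤ k → k + 1 ≤ B.K →
      RanBelow (budgetGate T s m S (4 * cδ / r) (fun i => ψ * α i)) (k + 1) →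
      ∀ U, (fun z => Fn b k' k (U + z)) ∈ BddClass F (μ b k))
    (hD : ∀ b k, (D b k).Nonempty) (hϱ : ∀ b k' k, 0 < ϱ b k' k)
    (hB : ∀ (b : B.Birth) (k' k : ℕ), B.birthScale b ≤ k' → k' ≤ k → k + 1 ≤ B.K →
      RanBelow (budgetGate T s m S (4 * cδ / r) (fun i => ψ * α i)) (k + 1) →
      RealBaseAt (ref b k) (base b k) (𝒜 b k) (μ b k) (𝒦 b k' (k + 1)))
    (hE : ∀ (b : B.Birth) (k' k : ℕ), B.birthScale b ≤ k' → k' ≤ k → k + 1 ≤ B.K →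
      RanBelow (budgetGate T s m S (4 * cδ / r) (fun i => ψ * α i)) (k + 1) →
      ExponentSliceAt (ref b k) (𝒜 b k) (μ b k) latMove latN (𝒦 b k' (k + 1)) (wk b k' (k + 1)) (ϱ b k' k) (s b k))
    (hP : ∀ (b : B.Birth) (k' k : ℕ), B.birthScale b ≤ k' → k' ≤ k → k + 1 ≤ B.K →
      RanBelow (budgetGate T s m S (4 * cδ / r) (fun i => ψ * α i)) (k + 1) →
      PertSlice (fun U z => 𝒬 b k U z - q b k U) (μ b k) latMove latN (𝒦 b k' (k + 1)) (wk b k' (k + 1)) (ϱ b k' k)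
        (m * ∑ f ∈ S k b, T.envVar (4 * cδ / r) (fun i => ψ * α i) f k))
    (hDμ : ∀ b k, ∀ᵐ z ∂μ b k, z ∈ D b k)
    (hN1 : ∀ (b : B.Birth) (k' k : ℕ), B.birthScale b ≤ k' → k' ≤ k → k + 1 ≤ B.K →
      ∀ z ∈ D b k, ∀ U ∈ 𝒦 b k' (k + 1), U + z ∈ 𝒦 b k' k)
    -- (N2) RE-CUT: chart motions of declared bound ≤ the NEXT step's window only
    (hN2 : ∀ (b : B.Birth) (k' k : ℕ), B.birthScale b ≤ k' → k' ≤ k → k + 1 ≤ B.K →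
      ∀ U₀ ∈ 𝒦 b k' (k + 1), ∀ p : NDir d R, latN p ≤ wk b k' (k + 1) → ∀ z' ∈ D b k,
        latMove U₀ p 1 + z' ∈ 𝒦 b k' k)
    (hdiam : ∀ b k, ∀ z ∈ D b k, ∀ z' ∈ D b k, ∀ x ν, ‖z x ν - z' x ν‖ ≤ θ b k)
    (hθ : ∀ b k, 0 < θ b k ∧ θ b k ≤ w) (hθwk : ∀ b k' k, θ b k ≤ wk b k' k)
    (hwk : ∀ b k' k, wk b k' k ≤ w) (hwk_anti : ∀ b k' k, wk b k' (k + 1) ≤ wk b k' k)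
    (hdom : ∀ (b : B.Birth) (k' k : ℕ), B.birthScale b ≤ k' → k' ≤ k → k + 1 ≤ B.K →
      Real.exp 3 * (1 + 4 * θ b k / ϱ b k' k) ≤ α k)
    (hinv : ∀ b k' k, GaugeInvariant (rel b k' k) (Fn b k' k))
    (hdefwk : ∀ b k' k, defect b k' k ≤ wk b k' k)
    (hrate : ∀ (b : B.Birth) (k' k : ℕ), B.birthScale b ≤ k' → k' ≤ k → k ≤ B.K →
      defect b k' k ≤ cδ * ψ ^ (k - k'))
    (hlin : ∀ (b : B.Birth) (k' k : ℕ), B.birthScale b ≤ k' → k' ≤ k → k ≤ B.K →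
      RanBelow (budgetGate T s m S (4 * cδ / r) (fun i => ψ * α i)) k → ∀ ε > 0,
      ∃ U₀ ∈ 𝒦 b k' k, ∃ U₁ : Fld d R, RelGauge (rel b k' k) latMove latN U₀ U₁ (defect b k' k) ∧
        T.lin b k' k ≤ ‖Fn b k' k U₁ - Fn b k' k U₀‖ + ε) :
    T.TransportsFromVar (4 * cδ / r) (fun i => ψ * α i) (budgetGate T s m S (4 * cδ / r) (fun i => ψ * α i)) :=
  transportsFromVar_of_centredExponent_lattice_fam_gated_swin
    (Gate := budgetGate T s m S (4 * cδ / r) (fun i => ψ * α i))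
    (s₁ := fun b k => m * ∑ f ∈ S k b, T.envVar (4 * cδ / r) (fun i => ψ * α i) f k)
    hα hr hsl hFn h𝒢 hD hϱ hB hE hP (hs_of_budgetGate (T := T)) hDμ hN1 hN2 hdiam hθ hθwk hwk hwk_anti hdom hinv
    hdefwk hrate hlin

end ENDFswin

/-! ## §2 END-F-swin under row S1d's per-step window schedule [bookkeeping] -/

section Composition

variable {r w : ℝ} (W : WindowScheduleWin r w)
variable {B : T4TermFormat.Booking} {T : Trajectory B}
variable {R : Type*} [NormedRing R] [NormedAlgebra ℂ R] [MeasurableSpace R] {d : ℕ}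
  {F : Type*} [NormedAddCommGroup F] [NormedSpace ℂ F] [CompleteSpace F]

/-- **END-F-swin UNDER A PER-STEP WINDOW SCHEDULE** [bookkeeping]: `transportLeaf_of_centredExponent_swin` with windows
`𝒦 b k′ k := bondBall d (ρw k)`, fluctuation domains `D b k := bondBall d (σ k)`, diameters `θ b k := 2σ k`, chart radii
`ϱ b k′ k := ϱc k` and chart ∕ slice windows `wk b k′ k := wc k` read off a `WindowScheduleWin r w` — the nine geometric
binders `hD`, `hϱ`, `hN1`, `hN2`, `hdiam`, `hθ`, `hθwk`, `hwk`, `hwk_anti` DISCHARGED exactly as in row S1d's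
`transportLeaf_win_of_schedule` (`hN2_of_schedule` etc. by name, the shared one-liners inline).  Births are asked on the window
`wc k′`, the action exponent and `hP` on `wc (k+1)`.  With `WindowScheduleWin.geometric` the birth window is the cutoff-free
`ρ∞ + (1+2q)σ₀/(1−q)` (`geometric_birthWindow`).  Conclusion: VERBATIM the field type of `BookingLeaves.htr`. [folklore] -/
theorem transportLeaf_swin_of_schedule {Fn : B.Birth → ℕ → ℕ → Fld d R → F}
    {rel : B.Birth → ℕ → ℕ → Fld d R → Fld d R → Prop}
    {ref : B.Birth → ℕ → Fld d R → Fld d R} {base : B.Birth → ℕ → Fld d R → ℝ}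
    {𝒜 𝒬 : B.Birth → ℕ → Fld d R → Fld d R → ℂ} {q : B.Birth → ℕ → Fld d R → ℂ}
    {μ : B.Birth → ℕ → Measure (Fld d R)} {z₀ : B.Birth → ℕ → Fld d R}
    {defect : B.Birth → ℕ → ℕ → ℝ} {cδ ψ m : ℝ} {s : B.Birth → ℕ → ℝ} {α : ℕ → ℝ}
    {S : ℕ → B.Birth → Finset B.Birth}
    (hα : ∀ i, 0 ≤ α i) (hr : 0 < r)
    (hsl : ∀ (b : B.Birth) (k' : ℕ), B.birthScale b ≤ k' → k' ≤ B.K →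
      RanBelow (budgetGate T s m S (4 * cδ / r) (fun i => ψ * α i)) k' →
      BirthSlice (Fn b k' k') latMove latN (bondBall d (W.ρw k') : Set (Fld d R)) (W.wc k') r (T.gen b k'))
    (hFn : ∀ (b : B.Birth) (k' k : ℕ), B.birthScale b ≤ k' → k' ≤ k → k + 1 ≤ B.K →
      RanBelow (budgetGate T s m S (4 * cδ / r) (fun i => ψ * α i)) (k + 1) →
      ∀ U, Fn b k' (k + 1) U =
        wOp (expWeight (base b k) (𝒜 b k + 𝒬 b k)) (μ b k) (z₀ b k) U (fun z => Fn b k' k (U + z)))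
    (h𝒢 : ∀ (b : B.Birth) (k' k : ℕ), B.birthScale b ≤ k' → k' ≤ k → k + 1 ≤ B.K →
      RanBelow (budgetGate T s m S (4 * cδ / r) (fun i => ψ * α i)) (k + 1) →
      ∀ U, (fun z => Fn b k' k (U + z)) ∈ BddClass F (μ b k))
    (hB : ∀ (b : B.Birth) (k' k : ℕ), B.birthScale b ≤ k' → k' ≤ k → k + 1 ≤ B.K →
      RanBelow (budgetGate T s m S (4 * cδ / r) (fun i => ψ * α i)) (k + 1) →
      RealBaseAt (ref b k) (base b k) (𝒜 b k) (μ b k) (bondBall d (W.ρw (k + 1)) : Set (Fld d R)))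
    (hE : ∀ (b : B.Birth) (k' k : ℕ), B.birthScale b ≤ k' → k' ≤ k → k + 1 ≤ B.K →
      RanBelow (budgetGate T s m S (4 * cδ / r) (fun i => ψ * α i)) (k + 1) →
      ExponentSliceAt (ref b k) (𝒜 b k) (μ b k) latMove latN (bondBall d (W.ρw (k + 1)) : Set (Fld d R)) (W.wc (k + 1))
        (W.ϱc k) (s b k))
    (hP : ∀ (b : B.Birth) (k' k : ℕ), B.birthScale b ≤ k' → k' ≤ k → k + 1 ≤ B.K →
      RanBelow (budgetGate T s m S (4 * cδ / r) (fun i => ψ * α i)) (k + 1) →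
      PertSlice (fun U z => 𝒬 b k U z - q b k U) (μ b k) latMove latN (bondBall d (W.ρw (k + 1)) : Set (Fld d R))
        (W.wc (k + 1)) (W.ϱc k) (m * ∑ f ∈ S k b, T.envVar (4 * cδ / r) (fun i => ψ * α i) f k))
    (hDμ : ∀ b k, ∀ᵐ z ∂μ b k, z ∈ (bondBall d (W.σ k) : Set (Fld d R)))
    (hdom : ∀ k, k + 1 ≤ B.K → Real.exp 3 * (1 + 4 * (2 * W.σ k) / W.ϱc k) ≤ α k)
    (hinv : ∀ b k' k, GaugeInvariant (rel b k' k) (Fn b k' k))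
    (hdefwk : ∀ (_b : B.Birth) (_k' k : ℕ), defect _b _k' k ≤ W.wc k)
    (hrate : ∀ (b : B.Birth) (k' k : ℕ), B.birthScale b ≤ k' → k' ≤ k → k ≤ B.K →
      defect b k' k ≤ cδ * ψ ^ (k - k'))
    (hlin : ∀ (b : B.Birth) (k' k : ℕ), B.birthScale b ≤ k' → k' ≤ k → k ≤ B.K →
      RanBelow (budgetGate T s m S (4 * cδ / r) (fun i => ψ * α i)) k → ∀ ε > 0,
      ∃ U₀ ∈ (bondBall d (W.ρw k) : Set (Fld d R)), ∃ U₁ : Fld d R,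
        RelGauge (rel b k' k) latMove latN U₀ U₁ (defect b k' k) ∧
        T.lin b k' k ≤ ‖Fn b k' k U₁ - Fn b k' k U₀‖ + ε) :
    T.TransportsFromVar (4 * cδ / r) (fun i => ψ * α i) (budgetGate T s m S (4 * cδ / r) (fun i => ψ * α i)) :=
  transportLeaf_of_centredExponent_swin (𝒦 := fun _ _ k => (bondBall d (W.ρw k) : Set (Fld d R)))
    (D := fun _ k => (bondBall d (W.σ k) : Set (Fld d R))) (θ := fun _ k => 2 * W.σ k) (ϱ := fun _ _ k => W.ϱc k)
    (wk := fun _ _ k => W.wc k)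
    hα hr hsl hFn h𝒢 (fun _ k => ⟨0, fun x ν => by simpa using (W.hσ k).le⟩) (fun _ _ k => W.hϱc k) hB hE hP hDμ
    (fun _ _ k _ _ _ => bondBall_add_mem (by linarith [W.σ_add_wc_le_gap k, W.wc_pos (k + 1)])) (hN2_of_schedule W)
    (fun _ _ => bondBall_diam) (fun _ k => ⟨by linarith [W.hσ k], (W.hσwc k).trans (W.hwcw k)⟩) (hθwk_of_schedule W)
    (hwk_of_schedule W) (hwk_anti_of_schedule W) (fun _ _ k _ _ hk => hdom k hk) hinv hdefwk hrate hlin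

end Composition

end Summit.QuantumFields.BalabanUV.T4Continuum.NE1p.DressedRootSliceWin

end
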